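import Literature.NumberTheory.EllipticCurves.KellerYin2024.CharacterSelmerGroups
import Literature.NumberTheory.EllipticCurves.Agboola2007.RestrictedSelmerGroups
import HarnessLib

/-!
# Oukhaba–Viguié 2016, Thm. 1.2: `μ(X_∞) = 0` FOR ALL PRIMES `p` (including `p = 2, 3`) for the
# `𝔭`-ramified Iwasawa module over the split-prime `ℤ_p`-extension of an imaginary quadratic field —
# ONE named fact on the tree's character Selmer duals (same objects as the Greenberg 1978 file)

Topic `NumberTheory/IwasawaTheory` (namespace = path, paper sub-namespace `OukhabaViguie2016`). STATEMENT of one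
named fact (`def … : Prop`, D-0014; +1 declared debt: the proof — Gillard's algebraic independence of formal
multiplications + the Katz–de Shalit `p`-adic `L`-functions at `p = 2, 3`, §§3–7 of the source — has no
tree counterpart); no `sorry`, no `instance`, no notation. Typed by the
`bsd-2adic` cell (seat `bsd-2adic-t42` GEN 36) as print input (F1) of the GL(1) leaf
`TrivialCharSplitLineFiniteAt` of crux O2 (stmt-BirchSwinnertonDyer-24728); BSD is proved for no curve by
this; typed ≠ proved.

## The printed statement (held text `paper:arxiv-1311.3565`, arXiv v1 numbering = journal Thm. 1.2)

H. Oukhaba, S. Viguié, *On the `μ`-invariant of Katz `p`-adic `L`-functions attached to imaginary quadratic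
fields*, Forum Math. 28 (2016) 507–525 [OukhabaViguie2016MuInvariant]. §1 (p0001 L15–29): "Let `k ⊂ ℂ` be
an imaginary quadratic field … let `p` be a prime number which splits completely in `k`, that is
`p𝒪_k = 𝔭𝔭̄` … Let us also fix `K` a finite abelian extension of `k`. Then we denote by `K_∞` (resp.
`k_∞`) the unique `ℤ_p`-extension of `K` (resp. `k`) unramified outside of `𝔭` … `X_∞ := Gal(M_∞/K_∞)`,
where `M_∞` is the maximal abelian `p`-extension of `K_∞` unramified outside of `𝔭`. … `Λ := ℤ_p[[Γ]]` …
Greenberg has proved … that `X_∞` is a finitely generated torsion `Λ`-module … Using an isomorphism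
`Λ ≃ ℤ_p[[T]]` we may write a generator of the characteristic ideal of `X_∞` as `p^μ P(T)`, where `μ` is a
non-negative integer and `P(T)` is a distinguished polynomial. **Theorem 1.1.** (Gillard for all `k`,
[9, 10] and Schneps for `k` principal, [23]) The invariant `μ` vanishes for `p ≥ 5`." p0002 L5–7: "In this
paper we prove **Theorem 1.2. `μ = 0` for all `p`.** Our proof uses the approach of Gillard. It is valid for
any prime `p`." §7 (p0021 L1–13, p0023 L1–10): "`X_∞ = lim← Gal(M_n/K_n)` … `(X_∞)_{Γ_n} ≃ Gal(M_n/K_∞)`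
… Since `[M_n : K_∞] = #(X_∞)_{Γ_n} = p^{μ_∞ p^n + λ_∞ n + ν_∞}` for any `n >> 0`, where `μ_∞, λ_∞` and
`ν_∞` are the Iwasawa invariants of `X_∞` we deduce that (41) `μ_∞ = 0`, `λ_∞ = λ_an` and `ν_∞ = ν_an`. This
proves the theorem 1.2 given in the introduction."

## What is typed (the case `K = k` of the source: the base IS the imaginary quadratic field)

* `OukhabaViguie2016.thm12_splitPrime_muInvariant_eq_zero` — THE NAMED FACT, on the same objects as
  `Greenberg1978.splitPrime_iwasawaModule_finite_torsion` (file `SplitPrimeIwasawaModuleTorsion.lean`; the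
  dictionary: `κ` THE `ℤ_p`-line of `K` unramified outside `v` — Agboola's `ZpExtension.IsUnramifiedOutside`,
  unique by `ZpExtension.existsUnique_isUnramifiedOutside_of_split`; the trivial character module
  `KellerYin2024.charModule ∅ 1 ≅ ℚ_p/ℤ_p` (`charModuleEquiv`, action through `θ = 1`); `X` any
  Pontryagin-dual datum (`GreenbergVatsal2000.DatumDualData`, existence `KellerYin2024.unrDualData`) of
  `KellerYin2024.unrSelmer κ _ v̄ ∅ = H¹_{nr outside v}(K_∞, ℚ_p/ℤ_p) = X_∞^∨` — unramified at every `w ∤ p`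
  and above `v̄`, nothing above `v`, all conjugates —, so `X ≅ X_∞` as a group with `T` acting as
  `conj_γ − 1`, i.e. `X ≅ X_∞` as `Λ`-modules up to the involution `ι : γ ↦ γ⁻¹`; `μ` is `ι`-invariant):
  `muInvariant p X = 0`, ALL primes `p`.
* Consequence (proved by consumers, not here, to keep this file independent of the Greenberg 1978 file):
  under (F2) `Greenberg1978.splitPrime_iwasawaModule_finite_torsion` (f.g. `Λ`-torsion) and (F1) this fact,
  `X` is a finitely generated `ℤ_p`-module (Washington §13.2 = tree `muInvariant_eq_zero_iff_holds`) —
  Choi–Kezuka–Li's phrasing of the same theorem ("equivalent to saying that the Iwasawa `μ`-invariant …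
  vanishes", arXiv:1711.01697 p. 3 L21–24).
-- TODO(general form): the source proves `μ = 0` for `X_∞` over `K_∞ = K k_∞` for every finite ABELIAN
-- extension `K/k` of the imaginary quadratic field; only `K = k` is transcribed (the tree's `ZpExtension`
-- lives over the base field; the relative tower `K k_∞/K` needs the restriction of `κ` to `Γ_K`).

References: [OukhabaViguie2016MuInvariant] §1 Thm. 1.1–1.2 (arXiv:1311.3565 p0001 L15–36, p0002 L5–7), §7
(40)–(41) (p0023 L1–10); [Gillard1985] Thm. 2.9 (`p ≥ 5`); [Greenberg1978] §4; [Washington1997] §13.2;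
Choi–Kezuka–Li, arXiv:1711.01697 p. 3.
-/

noncomputable section

open scoped Classical

open NumberField IsDedekindDomain Field
open Literature.NumberTheory.EllipticCurves Literature.NumberTheory.EllipticCurves.GreenbergSelmer
  Literature.NumberTheory.EllipticCurves.GreenbergVatsal2000 Literature.NumberTheory.GaloisRepresentations

namespace Literature.NumberTheory.IwasawaTheory.OukhabaViguie2016

/-- **Oukhaba–Viguié 2016, Theorem 1.2 ("`μ = 0` for all `p`")**, base `K = k`. For an imaginary quadratic
field `K`, a prime `p = v v̄` SPLIT in `K` (`v ≠ v̄` above `p`; EVERY prime `p`, in particular `p = 2`),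
the `ℤ_p`-extension `κ` of `K` unramified outside `v` with a topological generator `γ`, and ANY
Pontryagin-dual datum `X` of `H¹_{nr outside v}(K_∞, ℚ_p/ℤ_p) = X_∞^∨`: the `μ`-invariant of the
`Λ = ℤ_p⟦T⟧`-module `X ≅ X_∞ = Gal(M_∞/K_∞)` vanishes. Named fact (the tree's `muInvariant`, the
exponent of `(p)` in the characteristic ideal; meaningful because `X` is finitely generated and torsion,
`Greenberg1978.splitPrime_iwasawaModule_finite_torsion`).
[cite: OukhabaViguie2016MuInvariant, Thm. 1.2 (arXiv:1311.3565 p0002 L6) with §1 (p0001 L15–29) and §7 (41) (p0023 L9)] -/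
def thm12_splitPrime_muInvariant_eq_zero : Prop :=
  ∀ (K : Type) [Field K] [NumberField K] (_hK : IsImaginaryQuadratic K) (p : ℕ) [Fact p.Prime]
    (v vbar : HeightOneSpectrum (𝓞 K)) (_hv : ((p : ℕ) : 𝓞 K) ∈ v.asIdeal)
    (_hvbar : ((p : ℕ) : 𝓞 K) ∈ vbar.asIdeal) (_hne : vbar ≠ v)
    (κ : ZpExtension K p) (_hκ : κ.IsUnramifiedOutside v)
    (γ : absoluteGaloisGroup K) (_hγ : κ.IsTopGenerator γ)
    (X : DatumDualData κ γ
      (KellerYin2024.charModule (∅ : Set (PadicAlgCl p))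
        (1 : FramedGaloisRep K (padicCoeffIntegers (∅ : Set (PadicAlgCl p))) 1))
      (Castella2018.AcSelmer.bdpData
        (KellerYin2024.charModule (∅ : Set (PadicAlgCl p))
        (1 : FramedGaloisRep K (padicCoeffIntegers (∅ : Set (PadicAlgCl p))) 1)) p vbar) ∅),
    muInvariant p X.X = 0

end Literature.NumberTheory.IwasawaTheory.OukhabaViguie2016

end
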